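import Mathlib.RingTheory.PowerSeries.Substitution
import Mathlib.RingTheory.PowerSeries.Order
import Mathlib.RingTheory.PowerSeries.Binomial
import Mathlib.NumberTheory.Padics.MahlerBasis
import Mathlib.Algebra.Polynomial.Div
import Literature.NumberTheory.EllipticCurves.PAdicLFunctionInvolutionProofs
import HarnessLib

/-!
# The functional equation of `L_p(f, α, T)` from the symmetry of the measure

Topic `NumberTheory/EllipticCurves` (the `p`-adic `L`-function of item C19,
`Literature.NumberTheory.EllipticCurves.padicLFunction`). Third layer of the proof of the functional equation of
the Mazur–Swinnerton-Dyer / Mazur–Tate–Teitelbaum `p`-adic `L`-function (Mazur–Tate–Teitelbaum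
1986, §I.17; Greenberg, LNM 1716, §1, pp. 67–68: "`L_p(E/ℚ, 2 - s) = w_E ⟨N_E⟩^{s-1} L_p(E/ℚ, s)`
… equivalent to the relation between `f_E^{anal}(T)` and `f_E^{anal}((1+T)^{-1} - 1)`"): the
`p`-adic analysis turning the symmetry of the measure `μ_{f,α}` under `x ↦ -1/(Nx)` into an
identity of power series.

* `subst_padicLFunction_eq_of_symmetry` (**main theorem**): let `L = L_p(f, α, T) = ∑ c_k T^k`,
  `c_k = lim_n RS(k, n)` (`padicLCoeff`, Riemann sums `padicLRiemannSum` of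
  `∫ (ℓ(x) choose k) dμ_{f,α}`). Assume (i) the Riemann sums converge, (ii) `μ_{f,α}` is bounded,
  (iii) `μ_{f,α}(u + p^{n+e₀}ℤ_p) = σ μ_{f,α}(u' + p^{n+e₀}ℤ_p)` whenever `N u u' ≡ -1`, and
  (iv) `N ≡ η_N γ^{c mod p^n} (mod p^{n+e₀})` for all `n` (`c ∈ ℤ_p` the exponent of `⟨N⟩`,
  `exists_teichmuller_exponent_natCast`). Then for every `ι ∈ ℚ_p⟦T⟧` with
  `(1 + T)(1 + ι) = 1` (i.e. `ι = T^ι = (1 + T)⁻¹ - 1`),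
  `L(ι(T)) = σ · (1 + T)^c · L(T)`, `(1 + T)^c = PowerSeries.binomialSeries ℚ_[p] c`.
  For the newform of an elliptic curve (i)–(iii) are theorems of the tree
  (`PAdicLFunctionInterpolationHoldsProofs`, `PAdicLFunctionFrickeSymmetryProofs`), assembled in
  `Literature/Barriers/BirchSwinnertonDyer/PAdicFunctionalEquationParityProofs`.

## The argument (coefficientwise, Mazur–Tate–Teitelbaum 1986, §I.13 and §I.17)

Write `R_n[g] = ∑_{η, s} μ(η γ^s + p^{n+e₀}) g(s)` for the level-`n` Riemann functional, so that
`RS(k, n) = R_n[(· choose k)]`. Fix `m`.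
1. `[T^m] L(ι) = ∑_{d ≤ m} c_d [T^m] ι^d` (`coeff_subst_eq_sum_range`; `ord ι^d ≥ d`) is the limit
   of `R_n[s ↦ ∑_{d ≤ m} (s choose d) [T^m] ι^d] = R_n[s ↦ [T^m] (1 + ι)^s] = R_n[s ↦ (-s choose m)]`,
   since `(1 + ι)^s = (1 + T)^{-s}` is the binomial series of exponent `-s`
   (`sum_range_coeff_pow_mul_choose`).
2. `[T^m] σ (1+T)^c L = σ ∑_{i+j=m} (c choose i) c_j` (`coeff_C_mul_binomialSeries_mul`) is the
   limit of `σ R_n[s ↦ ∑ (c choose i)(s choose j)] = σ R_n[s ↦ ((c + s) choose m)]` (Vandermonde,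
   `sum_range_choose_mul_natChoose`, Mathlib `Ring.add_choose_eq` in the binomial ring `ℤ_p`).
3. Reindexing along the involution (`finsum_sum_classes_eq_mul_of_symmetry`, layer 2):
   `R_n[s ↦ (-s choose m)] = σ R_n[s ↦ (-(-c̄ - s) choose m)]`, `c̄ = c mod p^n`, representatives
   in `[0, p^n)`.
4. `-(-c̄ - s) ≡ c + s (mod p^n ℤ_p)` (`exponent_add_val_add_val_mem_span`), and
   `x ↦ (x choose m)` is `p`-adically Lipschitz: `‖(x choose m) - (y choose m)‖ ≤ p^{-n}/‖m!‖` for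
   `x ≡ y (mod p^n)` (`norm_choose_sub_choose_le_of_sub_mem_span`: `m! (x choose m)` is an integer
   polynomial in `x`); with `‖μ‖ ≤ C` the two level-`n` sums of 1 and 2 differ by at most
   `‖σ‖ C p^{-n}/‖m!‖ → 0`, so their limits agree.

## References

* B. Mazur, J. Tate, J. Teitelbaum, *On `p`-adic analogues of the conjectures of Birch and
  Swinnerton-Dyer*, Invent. Math. 84 (1986), 1–48, §I.13, §I.17.
* R. Greenberg, *Iwasawa theory for elliptic curves*, LNM 1716 (1999), §1, pp. 67–68.
* L. C. Washington, *Introduction to cyclotomic fields*, GTM 83, §5.1 (Mahler, `(x choose n)`).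
-/

noncomputable section

open Filter Topology PowerSeries

namespace Literature.NumberTheory.EllipticCurves

/-! ### Power-series algebra: `ι = (1 + T)⁻¹ - 1` and binomial coefficients -/

section Algebra

variable {p : ℕ} [Fact p.Prime]

/-- If `(1 + T)(ι + 1) = 1` then `ι(0) = 0`. [folklore] -/
theorem constantCoeff_eq_zero_of_one_add_X_mul {R : Type*} [CommRing R] {ι : R⟦X⟧}
    (hι : (1 + X : R⟦X⟧) * (ι + 1) = 1) : constantCoeff ι = 0 := by
  have h := congr_arg constantCoeff hι
  rw [map_mul, map_add, map_add, map_one, constantCoeff_X, add_zero, one_mul] at h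
  linear_combination h

/-- `d ≤ ord (ι^d)` when `ι(0) = 0`. [folklore] -/
theorem le_order_pow_of_constantCoeff_eq_zero {R : Type*} [CommRing R] {ι : R⟦X⟧}
    (hι : constantCoeff ι = 0) (d : ℕ) : (d : ℕ∞) ≤ (ι ^ d).order := by
  have h1 : (1 : ℕ∞) ≤ ι.order := (one_le_order_iff_constCoeff_eq_zero).mpr hι
  calc (d : ℕ∞) = d • (1 : ℕ∞) := by simp
    _ ≤ d • ι.order := nsmul_le_nsmul_right h1 d
    _ ≤ (ι ^ d).order := le_order_pow ι d

/-- **Coefficients under substitution of a series without constant term**: if `ι(0) = 0` then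
`[T^m] L(ι(T)) = ∑_{d ≤ m} [T^m] ι^d · [T^d] L` (a finite sum, `ord ι^d ≥ d`). [folklore] -/
theorem coeff_subst_eq_sum_range {R : Type*} [CommRing R] {ι : R⟦X⟧} (hι : constantCoeff ι = 0)
    (L : R⟦X⟧) (m : ℕ) :
    coeff m (PowerSeries.subst ι L) =
      ∑ d ∈ Finset.range (m + 1), coeff m (ι ^ d) * coeff d L := by
  rw [coeff_subst' (HasSubst.of_constantCoeff_zero' hι),
    finsum_eq_sum_of_support_subset _ (s := Finset.range (m + 1)) ?_]
  · exact Finset.sum_congr rfl fun d _ ↦ by rw [smul_eq_mul, mul_comm]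
  · intro d hd
    rw [Function.mem_support] at hd
    rw [Finset.coe_range, Set.mem_Iio]
    by_contra h
    apply hd
    rw [coeff_of_lt_order m (lt_of_lt_of_le (by exact_mod_cast Nat.lt_of_succ_le (not_lt.mp h))
      (le_order_pow_of_constantCoeff_eq_zero hι d)), smul_zero]

/-- **`1 + ι = (1 + T)^{-1}` is the binomial series of exponent `-1 ∈ ℤ_p`** (both are inverses
of the unit `1 + T`; Mathlib `PowerSeries.binomialSeries`). [folklore] -/
theorem add_one_eq_binomialSeries_of_one_add_X_mul {ι : ℚ_[p]⟦X⟧}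
    (hι : (1 + X : ℚ_[p]⟦X⟧) * (ι + 1) = 1) :
    ι + 1 = PowerSeries.binomialSeries ℚ_[p] (-1 : ℤ_[p]) := by
  have h3 : PowerSeries.binomialSeries ℚ_[p] ((1 : ℕ) : ℤ_[p]) = 1 + X := by
    have := PowerSeries.binomialSeries_nat (R := ℤ_[p]) (A := ℚ_[p]) 1
    rwa [pow_one] at this
  have h2 : (1 + X : ℚ_[p]⟦X⟧) * PowerSeries.binomialSeries ℚ_[p] (-1 : ℤ_[p]) = 1 := by
    rw [← h3, ← PowerSeries.binomialSeries_add, Nat.cast_one, add_neg_cancel,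
      PowerSeries.binomialSeries_zero]
  have hu : IsUnit (1 + X : ℚ_[p]⟦X⟧) := by
    rw [PowerSeries.isUnit_iff_constantCoeff, map_add, map_one, constantCoeff_X, add_zero]
    exact isUnit_one
  exact hu.mul_left_cancel (hι.trans h2.symm)

/-- `(1 + ι)^t = (1 + T)^{-t}` is the binomial series of exponent `-t ∈ ℤ_p` (`t ∈ ℕ`).
[folklore] -/
theorem add_one_pow_eq_binomialSeries {ι : ℚ_[p]⟦X⟧} (hι : (1 + X : ℚ_[p]⟦X⟧) * (ι + 1) = 1)
    (t : ℕ) : (ι + 1) ^ t = PowerSeries.binomialSeries ℚ_[p] (-(t : ℤ_[p])) := by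
  induction t with
  | zero => rw [pow_zero, Nat.cast_zero, neg_zero, PowerSeries.binomialSeries_zero]
  | succ t ih =>
    rw [pow_succ, ih, add_one_eq_binomialSeries_of_one_add_X_mul hι,
      ← PowerSeries.binomialSeries_add]
    congr 1
    push_cast
    ring

/-- **`∑_{d ≤ m} (t choose d) [T^m] ι^d = (-t choose m)`** for `t ∈ ℕ`: the left side is
`[T^m] (1 + ι)^t` by the binomial theorem (terms with `d > m` or `d > t` vanish) and
`(1 + ι)^t = (1 + T)^{-t} = ∑_m (-t choose m) T^m` (`add_one_pow_eq_binomialSeries`), the binomial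
coefficient being taken in the binomial ring `ℤ_p`. [folklore] -/
theorem sum_range_coeff_pow_mul_choose {ι : ℚ_[p]⟦X⟧} (hι : (1 + X : ℚ_[p]⟦X⟧) * (ι + 1) = 1)
    (m t : ℕ) :
    ∑ d ∈ Finset.range (m + 1), coeff m (ι ^ d) * (t.choose d : ℚ_[p]) =
      algebraMap ℤ_[p] ℚ_[p] (Ring.choose (-(t : ℤ_[p])) m) := by
  have hι0 := constantCoeff_eq_zero_of_one_add_X_mul hι
  -- the coefficient of `T^m` in `(ι + 1)^t` by the binomial theorem
  have key : coeff m ((ι + 1) ^ t) =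
      ∑ d ∈ Finset.range (t + 1), coeff m (ι ^ d) * (t.choose d : ℚ_[p]) := by
    rw [add_pow, map_sum]
    refine Finset.sum_congr rfl fun d _ ↦ ?_
    rw [one_pow, mul_one, ← map_natCast (C (R := ℚ_[p])) (t.choose d), coeff_mul_C]
  -- both truncations agree with the sum over `range (t + m + 1)`
  have hvan1 : ∀ d ∈ Finset.range (t + m + 1), d ∉ Finset.range (t + 1) →
      coeff m (ι ^ d) * (t.choose d : ℚ_[p]) = 0 := by
    intro d _ hd
    rw [Finset.mem_range, not_lt] at hd
    rw [Nat.choose_eq_zero_of_lt (Nat.lt_of_succ_le hd), Nat.cast_zero, mul_zero]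
  have hvan2 : ∀ d ∈ Finset.range (t + m + 1), d ∉ Finset.range (m + 1) →
      coeff m (ι ^ d) * (t.choose d : ℚ_[p]) = 0 := by
    intro d _ hd
    rw [Finset.mem_range, not_lt] at hd
    rw [coeff_of_lt_order m (lt_of_lt_of_le (by exact_mod_cast Nat.lt_of_succ_le hd)
      (le_order_pow_of_constantCoeff_eq_zero hι0 d)), zero_mul]
  rw [Finset.sum_subset (Finset.range_subset_range.mpr (by omega)) hvan2,
    ← Finset.sum_subset (Finset.range_subset_range.mpr (by omega)) hvan1, ← key,
    add_one_pow_eq_binomialSeries hι t, PowerSeries.binomialSeries_coeff, Algebra.smul_def, mul_one]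

/-- Antidiagonal sums as range sums, reflected: `∑_{i+j=m} g(i) h(j) = ∑_{k ≤ m} g(m-k) h(k)`.
[folklore] -/
theorem sum_antidiagonal_eq_sum_range_reflect {R : Type*} [CommSemiring R] (g h : ℕ → R) (m : ℕ) :
    ∑ ij ∈ Finset.antidiagonal m, g ij.1 * h ij.2 =
      ∑ k ∈ Finset.range (m + 1), g (m - k) * h k := by
  rw [Finset.Nat.sum_antidiagonal_eq_sum_range_succ (fun i j ↦ g i * h j) m,
    ← Finset.sum_range_reflect (fun k ↦ g k * h (m - k)) (m + 1)]
  refine Finset.sum_congr rfl fun j hj ↦ ?_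
  rw [Finset.mem_range] at hj
  simp only [add_tsub_cancel_right]
  rw [Nat.sub_sub_self (by omega)]

/-- **`[T^m] (σ (1+T)^c L) = σ ∑_{k ≤ m} (c choose m-k) [T^k] L`** (Cauchy product with the
binomial series `(1 + T)^c = ∑ (c choose i) T^i`, `c ∈ ℤ_p`). [folklore] -/
theorem coeff_C_mul_binomialSeries_mul (σ : ℚ_[p]) (c : ℤ_[p]) (L : ℚ_[p]⟦X⟧) (m : ℕ) :
    coeff m (C σ * PowerSeries.binomialSeries ℚ_[p] c * L) =
      σ * ∑ k ∈ Finset.range (m + 1), algebraMap ℤ_[p] ℚ_[p] (Ring.choose c (m - k)) * coeff k L := by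
  rw [mul_assoc, coeff_C_mul, coeff_mul,
    sum_antidiagonal_eq_sum_range_reflect (fun i ↦ coeff i (PowerSeries.binomialSeries ℚ_[p] c))
      (fun j ↦ coeff j L) m]
  congr 1
  refine Finset.sum_congr rfl fun k _ ↦ ?_
  rw [PowerSeries.binomialSeries_coeff, Algebra.smul_def, mul_one]

/-- **Vandermonde**: `∑_{k ≤ m} (c choose m-k)(t choose k) = ((c + t) choose m)` for `c ∈ ℤ_p`,
`t ∈ ℕ` (Mathlib `Ring.add_choose_eq` in the binomial ring `ℤ_p`, `Ring.choose_natCast`).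
[folklore] -/
theorem sum_range_choose_mul_natChoose (c : ℤ_[p]) (m t : ℕ) :
    ∑ k ∈ Finset.range (m + 1), algebraMap ℤ_[p] ℚ_[p] (Ring.choose c (m - k)) * (t.choose k : ℚ_[p]) =
      algebraMap ℤ_[p] ℚ_[p] (Ring.choose (c + t) m) := by
  have hZ : ∑ k ∈ Finset.range (m + 1), Ring.choose c (m - k) * ((t.choose k : ℕ) : ℤ_[p]) =
      Ring.choose (c + t) m := by
    rw [Ring.add_choose_eq m (Commute.all _ _),
      sum_antidiagonal_eq_sum_range_reflect (fun i ↦ Ring.choose c i)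
        (fun j ↦ Ring.choose (t : ℤ_[p]) j) m]
    refine Finset.sum_congr rfl fun k _ ↦ ?_
    rw [Ring.choose_natCast]
  rw [← hZ, map_sum]
  refine Finset.sum_congr rfl fun k _ ↦ ?_
  rw [map_mul, map_natCast]

/-- **`p`-adic continuity of `x ↦ (x choose m)` on `ℤ_p`**: if `x ≡ y (mod p^n)` then
`‖(x choose m) - (y choose m)‖ ≤ p^{-n}/‖m!‖` in `ℚ_p`, because `m! (x choose m)` is the integer
polynomial `x(x-1)⋯(x-m+1)` (`descPochhammer`) evaluated at `x` (Mahler; Washington §5.1).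
[folklore] -/
theorem norm_choose_sub_choose_le_of_sub_mem_span {x y : ℤ_[p]} {n : ℕ} (m : ℕ)
    (h : x - y ∈ Ideal.span {(p : ℤ_[p]) ^ n}) :
    ‖algebraMap ℤ_[p] ℚ_[p] (Ring.choose x m) - algebraMap ℤ_[p] ℚ_[p] (Ring.choose y m)‖ ≤
      (p : ℝ) ^ (-n : ℤ) / ‖((m.factorial : ℕ) : ℚ_[p])‖ := by
  have hk : ((m.factorial : ℕ) : ℚ_[p]) ≠ 0 := by exact_mod_cast m.factorial_ne_zero
  rw [le_div_iff₀ (norm_pos_iff.mpr hk), ← norm_mul]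
  set Q : Polynomial ℤ_[p] := (descPochhammer ℤ m).map (algebraMap ℤ ℤ_[p]) with hQ
  have hQx : ∀ z : ℤ_[p], Q.eval z = m.factorial • Ring.choose z m := fun z ↦ by
    rw [hQ, Polynomial.eval_map, ← Polynomial.aeval_def, Polynomial.aeval_eq_smeval,
      Ring.descPochhammer_eq_factorial_smul_choose]
  have hdvd : (p : ℤ_[p]) ^ n ∣ m.factorial • (Ring.choose x m - Ring.choose y m) := by
    rw [smul_sub, ← hQx, ← hQx]
    exact (Ideal.mem_span_singleton.mp h).trans (Polynomial.sub_dvd_eval_sub x y Q)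
  have hnorm : ‖(m.factorial • (Ring.choose x m - Ring.choose y m) : ℤ_[p])‖ ≤ (p : ℝ) ^ (-n : ℤ) :=
    (PadicInt.norm_le_pow_iff_mem_span_pow _ n).mpr (Ideal.mem_span_singleton.mpr hdvd)
  have hcast : (algebraMap ℤ_[p] ℚ_[p] (Ring.choose x m) - algebraMap ℤ_[p] ℚ_[p] (Ring.choose y m)) *
      ((m.factorial : ℕ) : ℚ_[p]) =
      ((m.factorial • (Ring.choose x m - Ring.choose y m) : ℤ_[p]) : ℚ_[p]) := by
    rw [PadicInt.algebraMap_apply, PadicInt.algebraMap_apply, nsmul_eq_mul]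
    push_cast
    ring
  rw [hcast, PadicInt.padic_norm_e_of_padicInt]
  exact hnorm

end Algebra

/-! ### Linearity of the level-`n` Riemann functional -/

section Riemann

variable {N : ℕ} (f : CuspForm (CongruenceSubgroup.Gamma0 N) 2) {p : ℕ} [Fact p.Prime] (α : ℚ_[p])

/-- **Linearity of the Riemann sums in the integrand**: a finite combination
`∑_{d ∈ S} κ_d RS(d, n)` of the Riemann sums `RS(d, n) = ∑_{η, s} μ(η γ^s) (s choose d)`
(`padicLRiemannSum`) is the Riemann sum of `s ↦ ∑_{d ∈ S} κ_d (s choose d)`. [folklore] -/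
theorem sum_mul_padicLRiemannSum_eq (n : ℕ) (S : Finset ℕ) (κ : ℕ → ℚ_[p]) :
    ∑ d ∈ S, κ d * padicLRiemannSum f α d n =
      ∑ᶠ η : rootsOfUnity (torsionOrder p) ℤ_[p], ∑ s : ZMod (p ^ n),
        msdMeasure f α (n + cyclotomicExponent p)
            (PadicInt.toZModPow (n + cyclotomicExponent p) ((η : ℤ_[p]ˣ) : ℤ_[p]) *
              (cyclotomicGenerator p : ZMod (p ^ (n + cyclotomicExponent p))) ^ s.val) *
          ∑ d ∈ S, κ d * (s.val.choose d : ℚ_[p]) := by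
  classical
  haveI := neZero_torsionOrder p
  haveI := Fintype.ofFinite (rootsOfUnity (torsionOrder p) ℤ_[p])
  simp only [padicLRiemannSum, finsum_eq_sum_of_fintype, Finset.mul_sum]
  rw [Finset.sum_comm]
  refine Finset.sum_congr rfl fun η _ ↦ ?_
  rw [Finset.sum_comm]
  refine Finset.sum_congr rfl fun s _ ↦ Finset.sum_congr rfl fun d _ ↦ ?_
  ring

end Riemann

/-! ### The functional equation from the symmetry of the measure -/

section Main

variable {N : ℕ} {f : CuspForm (CongruenceSubgroup.Gamma0 N) 2} {p : ℕ} [Fact p.Prime] {α : ℚ_[p]}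

/-- **Functional equation of `L_p(f, α, T)` from the symmetry of `μ_{f,α}`** (Mazur–Tate–Teitelbaum
1986, §I.17; Greenberg, LNM 1716, §1, pp. 67–68). Let `L = L_p(f, α, T) = ∑ c_k T^k`
(`padicLFunction`, `c_k = padicLCoeff f α k`). Assume: the Riemann sums `padicLRiemannSum f α k n`
converge to `c_k`; `μ_{f,α}` is bounded; `μ_{f,α}(u + p^{n+e₀}) = σ μ_{f,α}(u' + p^{n+e₀})`
whenever `N u u' ≡ -1 (mod p^{n+e₀})` (the Fricke symmetry, `msdMeasure_eq_mul_of_isFrickeEigen`);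
and `N ≡ η_N γ^{c mod p^n} (mod p^{n+e₀})` for all `n` (`exists_teichmuller_exponent_natCast`:
`⟨N⟩ = γ^c`). Then for every `ι ∈ ℚ_p⟦T⟧` with `(1 + T)(1 + ι) = 1`, i.e. `ι = (1+T)⁻¹ - 1`,
`L(ι(T)) = σ · (1 + T)^c · L(T)` with `(1 + T)^c = PowerSeries.binomialSeries ℚ_[p] c` — Greenberg's
`L_p(E, 2 - s) = w_E ⟨N_E⟩^{s-1} L_p(E, s)` in the variable `1 + T = κ(γ)^{s-1}`. Proof:
coefficientwise limit argument described in the module docstring (binomial theorem, Vandermonde,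
reindexing along `x ↦ -1/(Nx)`, `p`-adic continuity of `(x choose m)`).
[cite: GreenbergLNM1716, §1 (functional equation, pp. 67–68)] -/
theorem subst_padicLFunction_eq_of_symmetry {σ : ℚ_[p]}
    (hsym : ∀ (n : ℕ) (u u' : ZMod (p ^ (n + cyclotomicExponent p))),
      (N : ZMod (p ^ (n + cyclotomicExponent p))) * u * u' = -1 →
        msdMeasure f α (n + cyclotomicExponent p) u = σ * msdMeasure f α (n + cyclotomicExponent p) u')
    (hbdd : ∃ C : ℝ, ∀ (n : ℕ) (a : ZMod (p ^ n)), ‖msdMeasure f α n a‖ ≤ C)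
    (htend : ∀ k : ℕ, Tendsto (padicLRiemannSum f α k) atTop (𝓝 (padicLCoeff f α k)))
    {ηN : rootsOfUnity (torsionOrder p) ℤ_[p]} {c : ℤ_[p]}
    (hc : ∀ n : ℕ, PadicInt.toZModPow (n + cyclotomicExponent p) ((ηN : ℤ_[p]ˣ) : ℤ_[p]) *
        (cyclotomicGenerator p : ZMod (p ^ (n + cyclotomicExponent p))) ^ (PadicInt.toZModPow n c).val =
          (N : ZMod (p ^ (n + cyclotomicExponent p))))
    {ι : ℚ_[p]⟦X⟧} (hι : (1 + X : ℚ_[p]⟦X⟧) * (ι + 1) = 1) :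
    PowerSeries.subst ι (padicLFunction f α) =
      C σ * PowerSeries.binomialSeries ℚ_[p] c * padicLFunction f α := by
  classical
  haveI := neZero_torsionOrder p
  haveI := Fintype.ofFinite (rootsOfUnity (torsionOrder p) ℤ_[p])
  obtain ⟨C, hC⟩ := hbdd
  have hC0 : 0 ≤ C := (norm_nonneg _).trans (hC 0 0)
  have hι0 := constantCoeff_eq_zero_of_one_add_X_mul hι
  ext m
  rw [coeff_subst_eq_sum_range hι0, coeff_C_mul_binomialSeries_mul]
  -- level-`n` approximants of the two sides
  set u : ℕ → ℚ_[p] := fun n ↦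
    ∑ d ∈ Finset.range (m + 1), coeff m (ι ^ d) * padicLRiemannSum f α d n with hu_def
  set v : ℕ → ℚ_[p] := fun n ↦
    σ * ∑ k ∈ Finset.range (m + 1),
      algebraMap ℤ_[p] ℚ_[p] (Ring.choose c (m - k)) * padicLRiemannSum f α k n with hv_def
  have hu : Tendsto u atTop
      (𝓝 (∑ d ∈ Finset.range (m + 1), coeff m (ι ^ d) * coeff d (padicLFunction f α))) := by
    simp only [hu_def, coeff_padicLFunction]
    exact tendsto_finsetSum _ fun d _ ↦ (htend d).const_mul _
  have hv : Tendsto v atTop (𝓝 (σ * ∑ k ∈ Finset.range (m + 1),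
      algebraMap ℤ_[p] ℚ_[p] (Ring.choose c (m - k)) * coeff k (padicLFunction f α))) := by
    simp only [hv_def, coeff_padicLFunction]
    exact (tendsto_finsetSum _ fun k _ ↦ (htend k).const_mul _).const_mul σ
  suffices hdiff : Tendsto (fun n ↦ u n - v n) atTop (𝓝 0) by
    exact sub_eq_zero.mp (tendsto_nhds_unique (hu.sub hv) hdiff)
  -- the estimate `‖u n - v n‖ ≤ ‖σ‖ C p^{-n} / ‖m!‖`
  have hp1 : (1 : ℝ) < p := by exact_mod_cast (Fact.out : p.Prime).one_lt
  have hbound : ∀ n, ‖u n - v n‖ ≤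
      ‖σ‖ * (C * ((p : ℝ) ^ (-n : ℤ) / ‖((m.factorial : ℕ) : ℚ_[p])‖)) := by
    intro n
    -- `u n = R_n[s ↦ (-s choose m)]`, `v n = σ R_n[s ↦ ((c + s) choose m)]`
    have huA : u n = ∑ᶠ η : rootsOfUnity (torsionOrder p) ℤ_[p], ∑ s : ZMod (p ^ n),
        msdMeasure f α (n + cyclotomicExponent p)
            (PadicInt.toZModPow (n + cyclotomicExponent p) ((η : ℤ_[p]ˣ) : ℤ_[p]) *
              (cyclotomicGenerator p : ZMod (p ^ (n + cyclotomicExponent p))) ^ s.val) *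
          algebraMap ℤ_[p] ℚ_[p] (Ring.choose (-(s.val : ℤ_[p])) m) := by
      rw [hu_def]
      dsimp only
      rw [sum_mul_padicLRiemannSum_eq]
      refine finsum_congr fun η ↦ Finset.sum_congr rfl fun s _ ↦ ?_
      rw [sum_range_coeff_pow_mul_choose hι m s.val]
    have hvB : v n = σ * ∑ᶠ η : rootsOfUnity (torsionOrder p) ℤ_[p], ∑ s : ZMod (p ^ n),
        msdMeasure f α (n + cyclotomicExponent p)
            (PadicInt.toZModPow (n + cyclotomicExponent p) ((η : ℤ_[p]ˣ) : ℤ_[p]) *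
              (cyclotomicGenerator p : ZMod (p ^ (n + cyclotomicExponent p))) ^ s.val) *
          algebraMap ℤ_[p] ℚ_[p] (Ring.choose (c + (s.val : ℤ_[p])) m) := by
      rw [hv_def]
      dsimp only
      rw [sum_mul_padicLRiemannSum_eq]
      congr 1
      refine finsum_congr fun η ↦ Finset.sum_congr rfl fun s _ ↦ ?_
      rw [sum_range_choose_mul_natChoose c m s.val]
    -- reindex `u n` along the involution
    have hre := finsum_sum_classes_eq_mul_of_symmetry p n (hsym n) (hc n)
      (fun s : ZMod (p ^ n) ↦ algebraMap ℤ_[p] ℚ_[p] (Ring.choose (-(s.val : ℤ_[p])) m))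
    rw [huA, hvB, hre, ← mul_sub, norm_mul, finsum_eq_sum_of_fintype, finsum_eq_sum_of_fintype,
      ← Finset.sum_sub_distrib]
    refine mul_le_mul_of_nonneg_left ?_ (norm_nonneg σ)
    refine IsUltrametricDist.norm_sum_le_of_forall_le_of_nonneg (by positivity) fun η _ ↦ ?_
    rw [← Finset.sum_sub_distrib]
    refine IsUltrametricDist.norm_sum_le_of_forall_le_of_nonneg (by positivity) fun s _ ↦ ?_
    rw [← mul_sub, norm_mul]
    refine mul_le_mul (hC _ _) ?_ (norm_nonneg _) hC0
    rw [norm_sub_rev]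
    refine norm_choose_sub_choose_le_of_sub_mem_span m ?_
    rw [sub_neg_eq_add]
    exact exponent_add_val_add_val_mem_span p c n s
  -- conclusion
  have h0 : Tendsto (fun n : ℕ ↦ (p : ℝ) ^ (-n : ℤ)) atTop (𝓝 0) := by
    have h := tendsto_pow_atTop_nhds_zero_of_lt_one (r := ((p : ℝ))⁻¹) (by positivity)
      (inv_lt_one_of_one_lt₀ hp1)
    refine h.congr fun n ↦ ?_
    rw [zpow_neg, zpow_natCast, inv_pow]
  have hK : Tendsto (fun n : ℕ ↦ ‖σ‖ * (C * ((p : ℝ) ^ (-n : ℤ) / ‖((m.factorial : ℕ) : ℚ_[p])‖)))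
      atTop (𝓝 0) := by
    simpa using ((h0.div_const ‖((m.factorial : ℕ) : ℚ_[p])‖).const_mul C).const_mul ‖σ‖
  exact squeeze_zero_norm hbound hK

end Main

end Literature.NumberTheory.EllipticCurves

end
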